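import Summits.Langlands.Langlands.Theorems.PicardMuOrdinaryMuOrdinaryFamilyRTPointBorelFrame

/-!
# The Picard point of line `free-seed-smooth-rt` (crux `MuOrdinaryFamilyRT`, stmt-Langlands-13757):
# the stable `𝒪₀`-line of a `ℚ̄₃`-triangularisation (LEAF `modelBorel`, main step)

Helper file for the registered stub `stub_point` (plan: `…PointPlan.lean`).  PROVED, for
`R : H → GL₃(𝒪₀)` reducing to `r : H → GL₃(𝔽₃)`, a residual frame `F₀` in which `r` is upper triangular
with pairwise distinct diagonal characters, and `g ∈ GL₃(ℚ̄₃)` triangularising `R`: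

* `exists_normalised_line` — the first column of `g`, rescaled at a coordinate of maximal norm, is an
  integral common eigenvector with integral eigenvalues `Ψ(τ)`, and reducing in `ℤ̄₃/𝔪̄` shows
  (`exists_eq_diag_of_common_eigenvector` in the frame `F₀`) that `Ψ mod 𝔪̄` is one residual diagonal
  character `χ_m`;
* **`exists_stable_integral_line`** — with `h` separating `χ_m(h) = w` from `χ_j(h) = χ_k(h) = u₀`
  (`exists_separating`), `charpoly R(h)` reduces to `(X - w)(X - u₀)²`; Hensel in `𝒪₀`
  (`IsAdicComplete.henselianRing`) gives a root `λ ≡ w`, `charpoly = (X - λ) q`, `q̄ = (X - u₀)²`;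
  `Ψ(h) = λ` (else `q(Ψ(h)) = 0` reduces to `(w - u₀)² = 0`); an `𝒪₀`-eigenvector of `R(h)` for `λ`
  (`Matrix.exists_mulVec_eq_zero_iff`), made primitive, lies on the line of the first column of `g`
  (else `(X - λ)² ∣ charpoly`, `sq_dvd_charpoly_of_eigenvectors`), hence is a common eigenvector:
  a primitive `c ∈ 𝒪₀³` with `R(τ) c = a(τ) c`, `a(τ) ∈ 𝒪₀`.
-/

-- `Summit.Langlands.Langlands.…` (summit = sub-problem name, D-0017 layout) trips `dupNamespace` on every decl.
set_option linter.dupNamespace false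

namespace Summit.Langlands.Langlands.Cruxes.MuOrdinaryFamilyRT.FreeSeedSmoothRt

open scoped Matrix Polynomial
open Polynomial IsLocalRing
open Literature.NumberTheory.GaloisRepresentations

noncomputable section

/-! ### The first line of a `ℚ̄₃`-triangularisation: normalisation and residual character -/

section Line

variable (ι : PadicAlgCl 3 ≃+* ℂ) (e : K →+* ℂ) {H : Type*} [Group H]
  (R : H →* GL (Fin 3) (O₀ ι e)) (r : H →* GL (Fin 3) (ZMod 3))
  (hRr : ∀ τ, (R τ).val.map (algebraMap (O₀ ι e) (ZMod 3)) = (r τ).val)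
  (F₀ : GL (Fin 3) (ZMod 3)) (hF₀ : ∀ τ, IsUpper3 (F₀⁻¹ * r τ * F₀).val)
  (g : GL (Fin 3) (PadicAlgCl 3))
  (hg : ∀ τ, IsUpper3 (g⁻¹ * Matrix.GeneralLinearGroup.map (j₀ ι e) (R τ) * g).val)

include hRr hF₀ hg in
/-- **Normalised first line and its residual character.**  The first column of `g`, rescaled to have
a coordinate `1` and all coordinates integral, is a common eigenvector of `R` with integral eigenvalues
`Ψ(τ)`, whose reductions are the values of ONE of the residual diagonal characters `χ_m` of the flag
`F₀`. -/
theorem exists_normalised_line :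
    letI := algebraZModPadicAlgClResidueField
    ∃ (i₀ m : Fin 3) (v : Fin 3 → PadicAlgCl 3) (Ψ : H → PadicAlgCl 3) (s : PadicAlgCl 3),
      v i₀ = 1 ∧ (∀ i, ‖v i‖ ≤ 1) ∧ s ≠ 0 ∧ v = s • (g.val *ᵥ Pi.single 0 1) ∧
      (∀ τ, (R τ).val.map (j₀ ι e) *ᵥ v = Ψ τ • v) ∧
      (∀ τ, ∃ hΨ : Ψ τ ∈ padicAlgClIntegers 3, residue (padicAlgClIntegers 3) ⟨Ψ τ, hΨ⟩ =
        algebraMap (ZMod 3) (padicAlgClResidueField 3) ((F₀⁻¹ * r τ * F₀).val m m)) := by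
  letI := algebraZModPadicAlgClResidueField
  -- the first column of `g`
  set v₀ : Fin 3 → PadicAlgCl 3 := g.val *ᵥ Pi.single 0 1 with hv₀
  have hv₀ne : v₀ ≠ 0 := by
    intro h0
    have : (Pi.single 0 1 : Fin 3 → PadicAlgCl 3) = 0 := by
      have := congrArg (fun w => (g⁻¹).val *ᵥ w) h0
      simpa only [hv₀, Matrix.mulVec_mulVec, ← Units.val_mul, inv_mul_cancel, Units.val_one, Matrix.one_mulVec,
        Matrix.mulVec_zero] using this
    exact absurd (congrFun this 0) (by simp)
  set Ψ : H → PadicAlgCl 3 := fun τ => (g⁻¹ * Matrix.GeneralLinearGroup.map (j₀ ι e) (R τ) * g).val 0 0 with hΨ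
  have hev₀ : ∀ τ, (R τ).val.map (j₀ ι e) *ᵥ v₀ = Ψ τ • v₀ := fun τ =>
    mulVec_col_zero_of_isUpper3 g (Matrix.GeneralLinearGroup.map (j₀ ι e) (R τ)) (hg τ)
  -- normalise at a coordinate of maximal norm
  obtain ⟨i₀, -, hi₀⟩ := Finset.exists_max_image Finset.univ (fun i => ‖v₀ i‖) Finset.univ_nonempty
  have hvi₀ : v₀ i₀ ≠ 0 := by
    intro h0
    apply hv₀ne
    ext i
    have := hi₀ i (Finset.mem_univ i)
    rw [h0, norm_zero] at this
    exact norm_le_zero_iff.mp this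
  set v : Fin 3 → PadicAlgCl 3 := (v₀ i₀)⁻¹ • v₀ with hv
  have hv1 : v i₀ = 1 := by simp [hv, hvi₀]
  have hvle : ∀ i, ‖v i‖ ≤ 1 := fun i => by
    rw [hv, Pi.smul_apply, smul_eq_mul, norm_mul, norm_inv]
    rw [inv_mul_le_iff₀ (norm_pos_iff.mpr hvi₀), mul_one]
    exact hi₀ i (Finset.mem_univ i)
  have hev : ∀ τ, (R τ).val.map (j₀ ι e) *ᵥ v = Ψ τ • v := fun τ => by
    rw [hv, Matrix.mulVec_smul, hev₀, smul_comm]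
  -- integrality of `Ψ`
  have hΨint : ∀ τ, ‖Ψ τ‖ ≤ 1 := fun τ => by
    have h1 : Ψ τ = ((R τ).val.map (j₀ ι e) *ᵥ v) i₀ := by rw [hev, Pi.smul_apply, smul_eq_mul, hv1, mul_one]
    rw [h1, Matrix.mulVec, dotProduct]
    refine norm_sum_fin_three_le_one _ fun l => ?_
    rw [norm_mul, Matrix.map_apply]
    exact mul_le_one₀ (norm_j₀_le_one ι e _) (norm_nonneg _) (hvle l)
  have hΨmem : ∀ τ, Ψ τ ∈ padicAlgClIntegers 3 := fun τ => (mem_padicAlgClIntegers_iff _).mpr (hΨint τ)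
  have hvmem : ∀ i, v i ∈ padicAlgClIntegers 3 := fun i => (mem_padicAlgClIntegers_iff _).mpr (hvle i)
  -- reduction
  set vO : Fin 3 → padicAlgClIntegers 3 := fun i => ⟨v i, hvmem i⟩ with hvO
  set vb : Fin 3 → padicAlgClResidueField 3 := fun i => residue _ (vO i) with hvb
  set ψb : H → padicAlgClResidueField 3 := fun τ => residue _ ⟨Ψ τ, hΨmem τ⟩ with hψb
  set rb : H → Matrix (Fin 3) (Fin 3) (padicAlgClResidueField 3) :=
    fun τ => (r τ).val.map (algebraMap (ZMod 3) (padicAlgClResidueField 3)) with hrb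
  have hvb1 : vb i₀ = 1 := by
    simp only [hvb, hvO]
    rw [← map_one (residue (padicAlgClIntegers 3))]
    congr 1
    exact Subtype.ext hv1
  have hvbne : vb ≠ 0 := fun h0 => one_ne_zero (hvb1.symm.trans (congrFun h0 i₀))
  have hevO : ∀ τ, ((R τ).val.map (jbar ι e)) *ᵥ vO = (⟨Ψ τ, hΨmem τ⟩ : padicAlgClIntegers 3) • vO := by
    intro τ
    ext i
    have lhs : (((((R τ).val.map (jbar ι e)) *ᵥ vO) i : padicAlgClIntegers 3) : PadicAlgCl 3) =
        ((R τ).val.map (j₀ ι e) *ᵥ v) i := by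
      change (padicAlgClIntegers 3).subtype ((((R τ).val.map (jbar ι e)) *ᵥ vO) i) = _
      rw [RingHom.map_mulVec, Matrix.map_map]
      rfl
    rw [lhs, hev]
    rfl
  have hcomp : ((residue (padicAlgClIntegers 3) : padicAlgClIntegers 3 → padicAlgClResidueField 3) ∘ (jbar ι e)) =
      (algebraMap (ZMod 3) (padicAlgClResidueField 3)) ∘ (algebraMap (O₀ ι e) (ZMod 3)) :=
    funext fun x => residue_jbar ι e x
  have hevb : ∀ τ, rb τ *ᵥ vb = ψb τ • vb := by
    intro τ
    ext i
    have h1 := congrArg (residue (padicAlgClIntegers 3)) (congrFun (hevO τ) i)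
    rw [RingHom.map_mulVec, Matrix.map_map, hcomp, ← Matrix.map_map, hRr, Pi.smul_apply, smul_eq_mul, map_mul] at h1
    rw [Pi.smul_apply, smul_eq_mul]
    exact h1
  -- in the frame `F₀`
  set F₀b : GL (Fin 3) (padicAlgClResidueField 3) :=
    Matrix.GeneralLinearGroup.map (algebraMap (ZMod 3) (padicAlgClResidueField 3)) F₀ with hF₀b
  set T : H → Matrix (Fin 3) (Fin 3) (padicAlgClResidueField 3) :=
    fun τ => (F₀⁻¹ * r τ * F₀).val.map (algebraMap (ZMod 3) (padicAlgClResidueField 3)) with hT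
  have hTu : ∀ τ, IsUpper3 (T τ) := fun τ => by
    obtain ⟨h10, h20, h21⟩ := hF₀ τ
    exact ⟨by simp only [hT, Matrix.map_apply, h10, map_zero], by simp only [hT, Matrix.map_apply, h20, map_zero],
      by simp only [hT, Matrix.map_apply, h21, map_zero]⟩
  have hTeq : ∀ τ, T τ = (F₀b⁻¹).val * rb τ * F₀b.val := fun τ => by
    simp only [hT, hrb, hF₀b, Units.val_mul, Matrix.map_mul]
    rfl
  set u : Fin 3 → padicAlgClResidueField 3 := (F₀b⁻¹).val *ᵥ vb with hu
  have hune : u ≠ 0 := by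
    intro h0
    apply hvbne
    have := congrArg (fun w => F₀b.val *ᵥ w) h0
    simpa only [hu, Matrix.mulVec_mulVec, ← Units.val_mul, mul_inv_cancel, Units.val_one, Matrix.one_mulVec,
      Matrix.mulVec_zero] using this
  have hevu : ∀ τ, T τ *ᵥ u = ψb τ • u := fun τ => by
    rw [hTeq, hu, Matrix.mulVec_mulVec, Matrix.mul_assoc, ← Units.val_mul, mul_inv_cancel, Units.val_one, Matrix.mul_one,
      ← Matrix.mulVec_mulVec, hevb, Matrix.mulVec_smul]
  obtain ⟨m, -, -, hm⟩ := exists_eq_diag_of_common_eigenvector T hTu u hune ψb hevu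
  refine ⟨i₀, m, v, Ψ, (v₀ i₀)⁻¹, hv1, hvle, inv_ne_zero hvi₀, rfl, hev, fun τ => ⟨hΨmem τ, ?_⟩⟩
  have := hm τ
  simp only [hψb, hT, Matrix.map_apply] at this
  exact this

include hF₀ in
/-- The diagonal characters of a triangular frame are multiplicative. -/
theorem diag_mul (x y : H) (i : Fin 3) :
    (F₀⁻¹ * r (x * y) * F₀).val i i = (F₀⁻¹ * r x * F₀).val i i * (F₀⁻¹ * r y * F₀).val i i := by
  have : F₀⁻¹ * r (x * y) * F₀ = (F₀⁻¹ * r x * F₀) * (F₀⁻¹ * r y * F₀) := by rw [map_mul]; group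
  rw [this, Units.val_mul]
  exact IsUpper3.mul_apply_diag (hF₀ x) (hF₀ y) i

include hF₀ in
/-- The diagonal characters of a triangular frame are nowhere zero. -/
theorem diag_ne_zero (τ : H) (i : Fin 3) : (F₀⁻¹ * r τ * F₀).val i i ≠ 0 := by
  set T := F₀⁻¹ * r τ * F₀ with hT
  have hdet : T.val.det ≠ 0 := ((Matrix.isUnit_iff_isUnit_det _).mp T.isUnit).ne_zero
  rw [IsUpper3.det (hF₀ τ)] at hdet
  intro h
  apply hdet
  fin_cases i
  · simp only [Fin.zero_eta, Fin.isValue] at h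
    rw [h, zero_mul, zero_mul]
  · simp only [Fin.mk_one, Fin.isValue] at h
    rw [h, mul_zero, zero_mul]
  · simp only [Fin.reduceFinMk, Fin.isValue] at h
    rw [h, mul_zero]

include hRr hF₀ hg in
/-- **The stable `𝒪₀`-line.**  If the residual diagonal characters of `F₀` are pairwise distinct, the
first line of the `ℚ̄₃`-flag `g` is `𝒪₀`-rational: there is a primitive `c ∈ 𝒪₀³` (`c(i₁) = 1`)
spanning it, a common eigenvector of all `R(τ)` with eigenvalues in `𝒪₀`. -/
theorem exists_stable_integral_line
    (hdist : ∀ i j : Fin 3, i ≠ j → (fun τ => (F₀⁻¹ * r τ * F₀).val i i) ≠ fun τ => (F₀⁻¹ * r τ * F₀).val j j) :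
    ∃ (c : Fin 3 → O₀ ι e) (i₁ : Fin 3) (a : H → O₀ ι e) (t : PadicAlgCl 3),
      c i₁ = 1 ∧ (∀ τ, (R τ).val *ᵥ c = a τ • c) ∧ t ≠ 0 ∧ (fun i => j₀ ι e (c i)) = t • (g.val *ᵥ Pi.single 0 1) := by
  letI := algebraZModPadicAlgClResidueField
  obtain ⟨i₀, m, v, Ψ, s, hv1, hvle, hs, hvs, hev, hres⟩ := exists_normalised_line ι e R r hRr F₀ hF₀ g hg
  -- (1) a separating element `h`: `χ_m(h) = w ≠ u₀ = χ_j(h) = χ_k(h)`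
  have hidx : ∀ m : Fin 3, m ≠ m + 1 ∧ m ≠ m + 2 ∧ m + 1 ≠ m + 2 := by decide
  obtain ⟨hmj, hmk, hjk⟩ := hidx m
  have hsq : ∀ x : ZMod 3, x ≠ 0 → x * x = 1 := by decide
  obtain ⟨h, hh1, hh2⟩ := exists_separating (k := ZMod 3) (fun τ => (F₀⁻¹ * r τ * F₀).val m m)
    (fun τ => (F₀⁻¹ * r τ * F₀).val (m + 1) (m + 1)) (fun τ => (F₀⁻¹ * r τ * F₀).val (m + 2) (m + 2)) (by decide)
    (fun x y => diag_mul r F₀ hF₀ x y m) (fun x y => diag_mul r F₀ hF₀ x y (m + 1)) (fun x y => diag_mul r F₀ hF₀ x y (m + 2))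
    (fun x => hsq _ (diag_ne_zero r F₀ hF₀ x m)) (fun x => hsq _ (diag_ne_zero r F₀ hF₀ x (m + 1)))
    (fun x => hsq _ (diag_ne_zero r F₀ hF₀ x (m + 2))) (hdist m (m + 1) hmj) (hdist m (m + 2) hmk)
  obtain ⟨w, hw⟩ : ∃ w : ZMod 3, w = (F₀⁻¹ * r h * F₀).val m m := ⟨_, rfl⟩
  obtain ⟨u₀, hu₀⟩ : ∃ u₀ : ZMod 3, u₀ = (F₀⁻¹ * r h * F₀).val (m + 1) (m + 1) := ⟨_, rfl⟩
  rw [← hw, ← hu₀] at hh1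
  rw [← hu₀] at hh2
  have hwu : w ≠ u₀ := hh1
  -- (2) the characteristic polynomial of `R(h)` reduces to `(X - w)(X - u₀)²`
  set π := algebraMap (O₀ ι e) (ZMod 3) with hπ
  set p : (O₀ ι e)[X] := (R h).val.charpoly with hp
  have hpmonic : p.Monic := Matrix.charpoly_monic _
  have hpmap : p.map π = (X - C w) * (X - C u₀) ^ 2 := by
    have e1 : p.map π = (r h).val.charpoly := by rw [hp, ← Matrix.charpoly_map, hRr]
    have e2 : (r h).val.charpoly = (F₀⁻¹ * r h * F₀).val.charpoly := by
      rw [Units.val_mul, Units.val_mul, Matrix.coe_units_inv, Matrix.charpoly_units_conj']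
    rw [e1, e2, Matrix.charpoly_of_upperTriangular _ (IsUpper3.blockTriangular (hF₀ h)), Fin.prod_univ_three, hw, hu₀]
    have hh2' := hh2
    rw [hu₀] at hh2'
    have f01 : (0 : Fin 3) + 1 = 1 := rfl
    have f02 : (0 : Fin 3) + 2 = 2 := rfl
    have f11 : (1 : Fin 3) + 1 = 2 := rfl
    have f12 : (1 : Fin 3) + 2 = 0 := rfl
    have f21 : (2 : Fin 3) + 1 = 0 := rfl
    have f22 : (2 : Fin 3) + 2 = 1 := rfl
    fin_cases m
    · simp only [Fin.zero_eta, Fin.isValue, f01, f02] at hh2' ⊢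
      rw [← hh2']; ring
    · simp only [Fin.mk_one, Fin.isValue, f11, f12] at hh2' ⊢
      rw [hh2']; ring
    · simp only [Fin.reduceFinMk, Fin.isValue, f21, f22] at hh2' ⊢
      rw [hh2']; ring
  -- (3) Hensel: a root `λ ∈ 𝒪₀` of `p` reducing to `w`, `p = (X - λ) q`, `q̄ = (X - u₀)²`
  obtain ⟨a₀, ha₀⟩ := algebraMap_O₀_ZMod_surjective ι e w
  have heval : p.eval a₀ ∈ maximalIdeal (O₀ ι e) := by
    rw [← ker_algebraMap_O₀_ZMod, RingHom.mem_ker, ← hπ, ← eval₂_at_apply, ← eval_map, hpmap, ha₀]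
    simp
  have hderiv : IsUnit (Ideal.Quotient.mk (maximalIdeal (O₀ ι e)) (p.derivative.eval a₀)) := by
    have hnot : p.derivative.eval a₀ ∉ maximalIdeal (O₀ ι e) := by
      rw [← ker_algebraMap_O₀_ZMod, RingHom.mem_ker, ← hπ, ← eval₂_at_apply, ← eval_map, ← derivative_map, hpmap, ha₀]
      simp only [derivative_mul, derivative_sub, derivative_X, derivative_C, sub_zero, one_mul, derivative_pow,
        Nat.cast_ofNat, eval_add, eval_pow, eval_sub, eval_X, eval_C, eval_mul, sub_self, zero_mul, add_zero,
        mul_one]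
      simpa using pow_ne_zero 2 (sub_ne_zero.mpr hwu)
    have hu : IsUnit (p.derivative.eval a₀) := by
      rwa [mem_maximalIdeal, mem_nonunits_iff, not_not] at hnot
    exact hu.map _
  obtain ⟨lam, hlamroot, hlam⟩ := HenselianRing.is_henselian (I := maximalIdeal (O₀ ι e)) p hpmonic a₀ heval hderiv
  have hπlam : π lam = w := by
    rw [← ker_algebraMap_O₀_ZMod, RingHom.mem_ker, map_sub, sub_eq_zero] at hlam
    rw [hlam, ha₀]
  set q := p /ₘ (X - C lam) with hq
  have hpq : (X - C lam) * q = p := mul_divByMonic_eq_iff_isRoot.mpr hlamroot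
  have hqmap : q.map π = (X - C u₀) ^ 2 := by
    have := congrArg (Polynomial.map π) hpq
    rw [Polynomial.map_mul, Polynomial.map_sub, map_X, map_C, hπlam, hpmap] at this
    exact (mul_left_cancel₀ (X_sub_C_ne_zero w) this)
  -- (4) `Ψ(h) = λ`
  set Mh : Matrix (Fin 3) (Fin 3) (PadicAlgCl 3) := (R h).val.map (j₀ ι e) with hMh
  have hMcp : Mh.charpoly = p.map (j₀ ι e) := Matrix.charpoly_map _ _
  have hvne : v ≠ 0 := fun h0 => one_ne_zero (hv1.symm.trans (congrFun h0 i₀))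
  have hfactor : p.map (j₀ ι e) = (X - C (j₀ ι e lam)) * q.map (j₀ ι e) := by
    rw [← hpq, Polynomial.map_mul, Polynomial.map_sub, map_X, map_C]
  obtain ⟨hΨmem, hΨres⟩ := hres h
  have hq_ne : (q.map (j₀ ι e)).eval (Ψ h) ≠ 0 := by
    intro h0
    -- in `ℤ̄₃`, then in its residue field
    have h1 : (q.map (jbar ι e)).eval ⟨Ψ h, hΨmem⟩ = 0 := by
      apply (padicAlgClIntegers 3).subtype_injective
      rw [map_zero, eval_map, hom_eval₂, ← h0, eval_map]
      rfl
    have h2 := congrArg (residue (padicAlgClIntegers 3)) h1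
    rw [map_zero, eval_map, hom_eval₂, hΨres,
      show (residue (padicAlgClIntegers 3)).comp (jbar ι e) = (algebraMap (ZMod 3) (padicAlgClResidueField 3)).comp π from
        RingHom.ext fun x => residue_jbar ι e x,
      ← eval₂_map, hqmap, ← hw, eval₂_at_apply] at h2
    simp only [eval_pow, eval_sub, eval_X, eval_C] at h2
    exact pow_ne_zero 2 (sub_ne_zero.mpr hwu) ((algebraMap (ZMod 3) (padicAlgClResidueField 3)).injective
      (h2.trans (map_zero _).symm))
  have hΨroot : (p.map (j₀ ι e)).eval (Ψ h) = 0 := by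
    rw [← hMcp, Matrix.eval_charpoly]
    refine Matrix.exists_mulVec_eq_zero_iff.mp ⟨v, hvne, ?_⟩
    rw [Matrix.sub_mulVec, scalar_mulVec, hMh, hev h, sub_self]
  have hΨlam : Ψ h = j₀ ι e lam := by
    rw [hfactor, eval_mul, eval_sub, eval_X, eval_C] at hΨroot
    exact sub_eq_zero.mp ((mul_eq_zero.mp hΨroot).resolve_right hq_ne)
  -- (5) an `𝒪₀`-eigenvector `x` of `R(h)` for `λ`, normalised to `ĉ`
  have hdetO : (Matrix.scalar (Fin 3) lam - (R h).val).det = 0 := by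
    rw [← Matrix.eval_charpoly]; exact hlamroot
  obtain ⟨x, hx0, hx⟩ := Matrix.exists_mulVec_eq_zero_iff.mpr hdetO
  have hRx : (R h).val *ᵥ x = lam • x := by
    rw [Matrix.sub_mulVec, scalar_mulVec, sub_eq_zero] at hx
    exact hx.symm
  set xh : Fin 3 → PadicAlgCl 3 := fun i => j₀ ι e (x i) with hxh
  have hxhne : xh ≠ 0 := by
    intro h0; apply hx0; funext i
    have := congrFun h0 i
    simp only [hxh, Pi.zero_apply] at this
    exact (map_eq_zero_iff _ (j₀_injective ι e)).mp this
  obtain ⟨i₁, -, hi₁⟩ := Finset.exists_max_image Finset.univ (fun i => ‖xh i‖) Finset.univ_nonempty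
  have hxi₁ : xh i₁ ≠ 0 := by
    intro h0; apply hxhne; ext i
    have := hi₁ i (Finset.mem_univ i)
    rw [h0, norm_zero] at this
    exact norm_le_zero_iff.mp this
  set ch : Fin 3 → PadicAlgCl 3 := (xh i₁)⁻¹ • xh with hch
  have hch1 : ch i₁ = 1 := by simp [hch, hxi₁]
  have hchle : ∀ i, ‖ch i‖ ≤ 1 := fun i => by
    rw [hch, Pi.smul_apply, smul_eq_mul, norm_mul, norm_inv, inv_mul_le_iff₀ (norm_pos_iff.mpr hxi₁), mul_one]
    exact hi₁ i (Finset.mem_univ i)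
  have hMxh : Mh *ᵥ xh = j₀ ι e lam • xh := by
    ext i
    have := congrArg (j₀ ι e) (congrFun hRx i)
    rw [RingHom.map_mulVec, Pi.smul_apply, smul_eq_mul, map_mul] at this
    exact this
  have hMch : Mh *ᵥ ch = Ψ h • ch := by
    rw [hch, Matrix.mulVec_smul, hMxh, smul_comm, hΨlam]
  -- (6) `ĉ` is on the line of `v` (multiplicity one), hence a common eigenvector
  have hcross : crossProduct ch v = 0 := by
    by_contra hne
    have hdvd := sq_dvd_charpoly_of_eigenvectors Mh (Ψ h) ch v hMch (hev h) hne
    rw [hMcp, hfactor, hΨlam, pow_two, mul_dvd_mul_iff_left (X_sub_C_ne_zero _), dvd_iff_isRoot] at hdvd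
    exact hq_ne (by rw [hΨlam]; exact hdvd)
  have hchv : ch = ch i₀ • v := eq_smul_of_cross_eq_zero ch v i₀ hv1 hcross
  have ht₀ : ch i₀ ≠ 0 := by
    intro h0
    rw [h0, zero_smul] at hchv
    exact one_ne_zero (hch1.symm.trans (congrFun hchv i₁))
  have hevch : ∀ τ, (R τ).val.map (j₀ ι e) *ᵥ ch = Ψ τ • ch := fun τ => by
    rw [hchv, Matrix.mulVec_smul, hev, smul_comm]
  -- (7) back to `𝒪₀`
  have hchE : ∀ i, ch i ∈ E₀ ι e := fun i => by
    simp only [hch, hxh, Pi.smul_apply, smul_eq_mul, j₀_apply]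
    exact mul_mem (inv_mem (x i₁ : E₀ ι e).2) (x i : E₀ ι e).2
  have hchO : ∀ i, (⟨ch i, hchE i⟩ : E₀ ι e) ∈ intermediateFieldIntegers 3 (E₀ ι e) := fun i => by
    rw [mem_intermediateFieldIntegers_iff]; exact hchle i
  set c : Fin 3 → O₀ ι e := fun i => ⟨⟨ch i, hchE i⟩, hchO i⟩ with hc
  have hjc : ∀ i, j₀ ι e (c i) = ch i := fun i => rfl
  set a : H → O₀ ι e := fun τ => ((R τ).val *ᵥ c) i₁ with ha
  have hja : ∀ τ, j₀ ι e (a τ) = Ψ τ := fun τ => by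
    simp only [ha]
    rw [RingHom.map_mulVec, show ((j₀ ι e : O₀ ι e → PadicAlgCl 3) ∘ c) = ch from funext hjc, hevch, Pi.smul_apply,
      smul_eq_mul, hch1, mul_one]
  refine ⟨c, i₁, a, ch i₀ * s, Subtype.ext (Subtype.ext hch1), fun τ => ?_, mul_ne_zero ht₀ hs, ?_⟩
  · funext i
    apply j₀_injective ι e
    rw [RingHom.map_mulVec, show ((j₀ ι e : O₀ ι e → PadicAlgCl 3) ∘ c) = ch from funext hjc, hevch, Pi.smul_apply,
      Pi.smul_apply, smul_eq_mul, smul_eq_mul, map_mul, hja, hjc]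
  · have e1 : (fun i => j₀ ι e (c i)) = ch := funext hjc
    rw [e1, mul_smul, ← hvs]
    exact hchv

end Line

/-- **Summary (registered helper goal of `stub_point`)**: the stable `𝒪₀`-line. -/
theorem pointBorelLine_exists : ∀ (ι : PadicAlgCl 3 ≃+* ℂ) (e : K →+* ℂ) {H : Type} [Group H] (R : H →* GL (Fin 3) (O₀ ι e)) (r : H →* GL (Fin 3) (ZMod 3)), (∀ τ, (R τ).val.map (algebraMap (O₀ ι e) (ZMod 3)) = (r τ).val) → ∀ (F₀ : GL (Fin 3) (ZMod 3)), (∀ τ, IsUpper3 (F₀⁻¹ * r τ * F₀).val) → ∀ (g : GL (Fin 3) (PadicAlgCl 3)), (∀ τ, IsUpper3 (g⁻¹ * Matrix.GeneralLinearGroup.map (j₀ ι e) (R τ) * g).val) → (∀ i j : Fin 3, i ≠ j → (fun τ => (F₀⁻¹ * r τ * F₀).val i i) ≠ fun τ => (F₀⁻¹ * r τ * F₀).val j j) → ∃ (c : Fin 3 → O₀ ι e) (i₁ : Fin 3) (a : H → O₀ ι e) (t : PadicAlgCl 3), c i₁ = 1 ∧ (∀ τ, (R τ).val *ᵥ c =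 a τ • c) ∧ t ≠ 0 ∧ (fun i => j₀ ι e (c i)) = t • (g.val *ᵥ Pi.single 0 1) :=
  fun ι e _ _ R r hRr F₀ hF₀ g hg hdist => exists_stable_integral_line ι e R r hRr F₀ hF₀ g hg hdist

end

end Summit.Langlands.Langlands.Cruxes.MuOrdinaryFamilyRT.FreeSeedSmoothRt
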